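import Mathlib
import Literature.NumberTheory.LFunctions.QuasiRHInvZetaBound
import Literature.NumberTheory.LFunctions.RiemannXiLogDeriv
import Literature.NumberTheory.LFunctions.RiemannXiProofs
import Literature.NumberTheory.LFunctions.ExplicitFormulaPsiOne
import Literature.NumberTheory.LFunctions.SuzukiSingleOperatorKernelProofs
import Literature.Analysis.SpecialFunctions.DigammaGauss
import Summits.RiemannHypothesis.RiemannHypothesis.Theorems.DeBrangesSuzukiDoorKernelSupportSymbolDecayUniform
import Summits.RiemannHypothesis.RiemannHypothesis.Theorems.DeBrangesSuzukiDoorKernelSupportLineIndependence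
import Summits.RiemannHypothesis.RiemannHypothesis.Theorems.DeBrangesSuzukiDoorKernelSupportVanishingGeneric
import Summits.RiemannHypothesis.RiemannHypothesis.Theorems.DeBrangesSuzukiDoorLaplaceWindow

/-!
(Module 2/6 of the v5 «SuzukiWeightedDoor» landing: C1 `ζ′/ζ` sub-log bound under a zero-free half-plane + C2 symbol decay.)
# v5 crux `WitnessOfZeroFree` — PROVED (RH-FREE implication): C1 `LogDerivSubLog`, C2 `SymbolDecayOnLines`, C3 line shift + growth, assembly

If `ξ ≠ 0` on `Re s > σ₀` (`1/2 ≤ σ₀ < 1`), then for `θ > 10`, `0 < δ ≤ 1/16` there is `C` with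
`‖Θ_θ(u+iy)‖ ≤ C |u|^{−θ/2}` for all lines `σ₀ − 1/2 + 4δ ≤ y ≤ 1` and `|u| ≥ 8`.
Inputs: C1 (`norm_logDeriv_zeta_le_rpow`, sub-logarithmic `ζ'/ζ`), the `ξ'/ξ` decomposition
`logDeriv_riemannZeta_eq_logDeriv_riemannXi`, `logDeriv_Gammaℝ`, the digamma lower bound `log_norm_sub_le_re_digamma`,
and `SuzukiDoor.norm_thetaSym_line`.  Nothing here bears on the truth of RH.
-/

set_option linter.dupNamespace false

noncomputable section

open Complex Metric Set Filter Topology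

namespace Summit.RiemannHypothesis.RiemannHypothesis.Theorems.SuzukiWeightedDoorLogDeriv

open Literature.NumberTheory.LFunctions InvZetaRH

variable {θ δ t : ℝ}

/-- The derivative of a holomorphic branch `L` of `log ζ` on a disc is `ζ'/ζ` there. -/
theorem deriv_branch_eq {L : ℂ → ℂ} {c : ℂ} {R : ℝ} (hLd : DifferentiableOn ℂ L (ball c R))
    (hexp : ∀ z ∈ ball c R, exp (L z) = riemannZeta z) {z : ℂ} (hz : z ∈ ball c R) :
    deriv L z = deriv riemannZeta z / riemannZeta z := by
  have hev : (fun w => exp (L w)) =ᶠ[𝓝 z] riemannZeta := by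
    filter_upwards [isOpen_ball.mem_nhds hz] with w hw using hexp w hw
  have hLz : DifferentiableAt ℂ L z := hLd.differentiableAt (isOpen_ball.mem_nhds hz)
  have hd : HasDerivAt (fun w => exp (L w)) (exp (L z) * deriv L z) z := hLz.hasDerivAt.cexp
  have h1 : deriv (fun w => exp (L w)) z = deriv riemannZeta z := hev.deriv_eq
  rw [hd.deriv, hexp z hz] at h1
  have hζ : riemannZeta z ≠ 0 := by rw [← hexp z hz]; exact exp_ne_zero _
  field_simp
  rw [← h1]; ring

/-- Cauchy's estimate for the branch. -/
theorem norm_deriv_le_of_bound {L : ℂ → ℂ} {c : ℂ} {R : ℝ} (hLd : DifferentiableOn ℂ L (ball c R))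
    {z : ℂ} {r M : ℝ} (hr : 0 < r) (hsub : closedBall z r ⊆ ball c R)
    (hM : ∀ w ∈ sphere z r, ‖L w‖ ≤ M) : ‖deriv L z‖ ≤ M / r := by
  have hdc : DiffContOnCl ℂ L (ball z r) := by
    refine DifferentiableOn.diffContOnCl ?_
    rw [closure_ball z hr.ne']
    exact hLd.mono hsub
  exact Complex.norm_deriv_le_of_forall_mem_sphere_norm_le hr hdc hM

/-- C1 (as in `LogDerivSubLog.lean`). -/
theorem norm_logDeriv_zeta_le_rpow (hQ : QuasiRiemannHypothesis θ) (hθ : 1 / 2 ≤ θ) (hθ1 : θ < 1)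
    (hδ : 0 < δ) (hδ4 : δ ≤ 1 / 4) (ht : 7 ≤ |t|) {σ : ℝ} (hσ₁ : θ + 4 * δ ≤ σ) (hσ₂ : σ ≤ 5 / 2) :
    ‖deriv riemannZeta (σ + t * I) / riemannZeta (σ + t * I)‖ ≤
      4 * B₂ * (A₃ / δ ^ 2 * Real.log |t|) ^
        (Real.log (6 - 2 * θ - 8 * δ) / Real.log (6 - 2 * θ - 4 * δ)) := by
  have hδ2 : δ ≤ 1 / 2 := by linarith
  obtain ⟨L, hLd, hexp, hV, hM⟩ := InvZetaQuasiRH.exists_log_riemannZeta hQ hθ hθ1 hδ hδ2 ht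
  set c : ℂ := ctr t with hc
  set R : ℝ := 3 - θ - δ / 2 with hRdef
  set a₁ : ℝ := Real.log (6 - 2 * θ - 8 * δ) / Real.log (6 - 2 * θ - 4 * δ) with ha₁def
  set M : ℝ := A₃ / δ * Real.log |t| with hMdef
  set M₃ : ℝ := A₃ / δ ^ 2 * Real.log |t| with hM₃def
  have hlog1 : 1 ≤ Real.log |t| := one_le_log_abs ht
  have h40 := forty_le_A₃_div hδ hδ2
  have hA₃pos : 0 < A₃ / δ := by linarith
  have hM₃eq : M₃ = M / δ := by rw [hM₃def, hMdef]; field_simp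
  have hM1 : 1 ≤ M := by rw [hMdef]; nlinarith
  have hM₃1 : 1 ≤ M₃ := by
    rw [hM₃eq, le_div_iff₀ hδ]; nlinarith
  have hB₂ := one_le_B₂
  have hFd : DifferentiableOn ℂ (deriv L) (ball c R) := hLd.deriv isOpen_ball
  have hM₁ : ∀ z : ℂ, ‖z - c‖ = 1 / 2 → ‖deriv L z‖ ≤ 4 * B₂ := by
    intro z hz
    have hsub : closedBall z (1 / 4) ⊆ ball c R := by
      intro w hw
      rw [mem_closedBall, dist_eq_norm] at hw
      rw [mem_ball, dist_eq_norm]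
      calc ‖w - c‖ = ‖(w - z) + (z - c)‖ := by ring_nf
        _ ≤ ‖w - z‖ + ‖z - c‖ := norm_add_le _ _
        _ < R := by rw [hz, hRdef]; linarith
    have hbd : ∀ w ∈ sphere z (1 / 4), ‖L w‖ ≤ B₂ := by
      intro w hw
      rw [mem_sphere, dist_eq_norm] at hw
      have hwball : w ∈ ball c R := hsub (by rw [mem_closedBall, dist_eq_norm, hw])
      have hzre : 5 / 2 ≤ z.re := by
        have h := abs_re_le_norm (z - c)
        rw [hz] at h
        simp only [sub_re, hc, ctr_re] at h
        have := neg_abs_le (z.re - 3)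
        linarith
      have hwre : 2 < w.re := by
        have h := abs_re_le_norm (w - z)
        rw [hw] at h
        simp only [sub_re] at h
        have := neg_abs_le (w.re - z.re)
        linarith
      rw [hV w hwball hwre]
      exact (norm_log_riemannZeta_le hwre.le).trans (le_max_left _ _)
    have := norm_deriv_le_of_bound hLd (by norm_num) hsub hbd
    linarith [this, show B₂ / (1 / 4 : ℝ) = 4 * B₂ by ring]
  have hM₃' : ∀ z : ℂ, ‖z - c‖ = 3 - θ - 2 * δ → ‖deriv L z‖ ≤ M₃ := by
    intro z hz
    have hsub : closedBall z δ ⊆ ball c R := by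
      intro w hw
      rw [mem_closedBall, dist_eq_norm] at hw
      rw [mem_ball, dist_eq_norm]
      calc ‖w - c‖ = ‖(w - z) + (z - c)‖ := by ring_nf
        _ ≤ ‖w - z‖ + ‖z - c‖ := norm_add_le _ _
        _ < R := by rw [hz, hRdef]; linarith
    have hbd : ∀ w ∈ sphere z δ, ‖L w‖ ≤ M := by
      intro w hw
      rw [mem_sphere, dist_eq_norm] at hw
      refine hM w ?_
      rw [mem_closedBall, dist_eq_norm]
      calc ‖w - c‖ = ‖(w - z) + (z - c)‖ := by ring_nf
        _ ≤ ‖w - z‖ + ‖z - c‖ := norm_add_le _ _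
        _ = 3 - θ - δ := by rw [hw, hz]; ring
    rw [hM₃eq]
    exact norm_deriv_le_of_bound hLd hδ hsub hbd
  set s₀ : ℂ := σ + t * I with hs₀def
  have hsc : s₀ - c = ((σ - 3 : ℝ) : ℂ) := by
    simp only [hs₀def, hc, ctr]; push_cast; ring
  have hnorm : ‖s₀ - c‖ = 3 - σ := by
    rw [hsc, Complex.norm_real, Real.norm_eq_abs, abs_of_nonpos (by linarith)]; ring
  have hs₀ball : s₀ ∈ ball c R := by
    rw [mem_ball, dist_eq_norm, hnorm, hRdef]; linarith
  have h13 : (1 / 2 : ℝ) < 3 - θ - 2 * δ := by linarith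
  have h3R : 3 - θ - 2 * δ < R := by rw [hRdef]; linarith
  have hz₁ : 1 / 2 ≤ ‖s₀ - c‖ := by rw [hnorm]; linarith
  have hz₃ : ‖s₀ - c‖ ≤ 3 - θ - 2 * δ := by rw [hnorm]; linarith
  have key := norm_le_of_three_circles (by norm_num) h13 h3R hFd hM₁ hM₃' hz₁ hz₃
  set a : ℝ := Real.log (‖s₀ - c‖ / (1 / 2)) / Real.log ((3 - θ - 2 * δ) / (1 / 2)) with hadef
  have hden : 0 < Real.log ((3 - θ - 2 * δ) / (1 / 2)) := Real.log_pos (by linarith)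
  have ha0 : 0 ≤ a := div_nonneg (Real.log_nonneg (by rw [hnorm]; linarith)) hden.le
  have ha1 : a ≤ a₁ := by
    rw [hadef, hnorm, ha₁def, show (3 - σ) / (1 / 2) = 6 - 2 * σ by ring,
      show (3 - θ - 2 * δ) / (1 / 2 : ℝ) = 6 - 2 * θ - 4 * δ by ring]
    exact div_le_div_of_nonneg_right (Real.log_le_log (by linarith) (by linarith))
      (Real.log_pos (by linarith)).le
  have ha₁1 : a₁ < 1 := by
    rw [ha₁def, div_lt_one (Real.log_pos (by linarith))]
    exact Real.log_lt_log (by linarith) (by linarith)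
  have ha1' : a ≤ 1 := ha1.trans ha₁1.le
  have h4B₂ : 1 ≤ 4 * B₂ := by linarith
  have e1 : (4 * B₂) ^ (1 - a) ≤ 4 * B₂ := by
    calc (4 * B₂) ^ (1 - a) ≤ (4 * B₂) ^ (1 : ℝ) := Real.rpow_le_rpow_of_exponent_le h4B₂ (by linarith)
      _ = 4 * B₂ := Real.rpow_one _
  have e2 : M₃ ^ a ≤ M₃ ^ a₁ := Real.rpow_le_rpow_of_exponent_le hM₃1 ha1
  rw [← deriv_branch_eq hLd hexp hs₀ball]
  calc ‖deriv L s₀‖ ≤ (4 * B₂) ^ (1 - a) * M₃ ^ a := key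
    _ ≤ 4 * B₂ * M₃ ^ a₁ := mul_le_mul e1 e2 (Real.rpow_nonneg (by linarith) _) (by linarith)

/-! ### C2: symbol decay on the lines `Im z = y ∈ [σ₀ − 1/2 + 4δ, 1]` -/

/-- The ξ-form of zero-freeness gives the tree's `QuasiRiemannHypothesis`. -/
theorem quasiRH_of_xi_zeroFree {σ₀ : ℝ} (hσ₀ : 0 ≤ σ₀)
    (hZ : ∀ s : ℂ, σ₀ < s.re → riemannXi s ≠ 0) : QuasiRiemannHypothesis σ₀ := by
  intro s hζ h1 h2
  exact hZ s h1 ((riemannXi_eq_zero_iff_holds s).2 ⟨hζ, by linarith, h2⟩)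

/-- Elementary: for `M ≥ 1`, `0 ≤ a < 1`, `ε > 0`: `M^a ≤ ε M + ε^{-(a/(1-a))}`. -/
theorem rpow_le_eps_mul_add {M a ε : ℝ} (hM : 1 ≤ M) (ha0 : 0 ≤ a) (ha1 : a < 1) (hε : 0 < ε) :
    M ^ a ≤ ε * M + ε ^ (-(a / (1 - a))) := by
  have hM0 : 0 < M := by linarith
  have h1a : 0 < 1 - a := by linarith
  set T : ℝ := ε ^ (-(1 / (1 - a))) with hT
  have hT0 : 0 < T := Real.rpow_pos_of_pos hε _
  have hεpow : 0 ≤ ε ^ (-(a / (1 - a))) := (Real.rpow_pos_of_pos hε _).le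
  rcases le_or_gt M T with hle | hgt
  · -- M ≤ T: M^a ≤ T^a = ε^{-(a/(1-a))}
    have h1 : M ^ a ≤ T ^ a := Real.rpow_le_rpow hM0.le hle ha0
    have h2 : T ^ a = ε ^ (-(a / (1 - a))) := by
      rw [hT, ← Real.rpow_mul hε.le]; congr 1; field_simp
    have h3 : 0 ≤ ε * M := by positivity
    linarith [h1, h2]
  · -- M > T: M^{a-1} ≤ T^{a-1} = ε, so M^a = M^{a-1} · M ≤ ε M
    have h1 : M ^ (a - 1) ≤ T ^ (a - 1) := Real.rpow_le_rpow_of_nonpos hT0 hgt.le (by linarith)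
    have h2 : T ^ (a - 1) = ε := by
      rw [hT, ← Real.rpow_mul hε.le]
      have : -(1 / (1 - a)) * (a - 1) = 1 := by field_simp; ring
      rw [this, Real.rpow_one]
    have h3 : M ^ a = M ^ (a - 1) * M := by
      conv_lhs => rw [show a = (a - 1) + 1 by ring]
      rw [Real.rpow_add hM0, Real.rpow_one]
    rw [h3]
    have h4 : M ^ (a - 1) * M ≤ ε * M := mul_le_mul_of_nonneg_right (h1.trans h2.le) hM0.le
    linarith

/-- Stirling-type lower bound: `Re Γℝ'/Γℝ(s) ≥ ½ log|Im s| − 3` for `0 < Re s`, `|Im s| ≥ 8`. -/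
theorem re_logDeriv_Gammaℝ_ge {s : ℂ} (hsre : 0 < s.re) (him : 8 ≤ |s.im|) :
    Real.log |s.im| / 2 - 3 ≤ (logDeriv Gammaℝ s).re := by
  have hpole : ∀ m : ℕ, s / 2 ≠ -(m : ℂ) := by
    intro m h
    have := congrArg Complex.re h
    simp at this
    linarith [(m.cast_nonneg : (0 : ℝ) ≤ m)]
  rw [Literature.NumberTheory.LFunctions.logDeriv_Gammaℝ hpole]
  set w : ℂ := s / 2 with hw
  have him0 : 0 < |s.im| := by linarith
  have hwre : 0 < w.re := by simp [hw]; linarith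
  have hwim : w.im = s.im / 2 := by simp [hw]
  have habsim : |w.im| = |s.im| / 2 := by rw [hwim, abs_div, abs_two]
  have hwim_ne : w.im ≠ 0 := by
    intro h; rw [h, abs_zero] at habsim; linarith
  have hψ := Literature.Analysis.SpecialFunctions.Complex.log_norm_sub_le_re_digamma hwre hwim_ne
  have hnorm_ge : |s.im| / 2 ≤ ‖w‖ := by rw [← habsim]; exact Complex.abs_im_le_norm w
  have hnorm_pos : 0 < ‖w‖ := by linarith
  have hlog_w : Real.log (|s.im| / 2) ≤ Real.log ‖w‖ := Real.log_le_log (by positivity) hnorm_ge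
  have hlog_split : Real.log (|s.im| / 2) = Real.log |s.im| - Real.log 2 :=
    Real.log_div him0.ne' two_ne_zero
  have hlog2 : Real.log 2 ≤ 1 := by
    have := Real.log_le_sub_one_of_pos (show (0 : ℝ) < 2 by norm_num); linarith
  have hAw : 1 / (2 * ‖w‖ ^ 2) ≤ 1 / 8 := by
    have h4 : 4 ≤ ‖w‖ := by linarith
    rw [div_le_div_iff₀ (by positivity) (by norm_num)]
    nlinarith
  have hBw : Real.pi / (4 * |w.im|) ≤ Real.pi / 16 := by
    rw [habsim]
    apply div_le_div_of_nonneg_left Real.pi_pos.le (by norm_num)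
    linarith
  have hπ : Real.pi / 16 ≤ 1 / 2 := by linarith [Real.pi_lt_four]
  have hlogπ : Real.log Real.pi ≤ 2 := log_pi_lt_two.le
  have hre : (-(Complex.log Real.pi) / 2 + Complex.digamma w / 2).re =
      -(Real.log Real.pi) / 2 + (Complex.digamma w).re / 2 := by
    rw [← Complex.ofReal_log Real.pi_pos.le]
    simp [Complex.add_re, Complex.neg_re]
  rw [hre]
  linarith [hψ, hlog_w, hlog_split, hlog2, hAw, hBw, hπ, hlogπ]

/-- Lower bound for `Re ξ'/ξ` on `Re s = σ ∈ [σ₀ + 4δ, 3/2]`, `|Im s| ≥ 8`, in a zero-free half-plane `Re s > σ₀`: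
`Re ξ'/ξ(σ − iu) ≥ ½ log|u| − 4 − 4B₂ (A₃δ⁻² log|u|)^{a₁}`. -/
theorem re_logDeriv_xi_ge {σ₀ δ σ u : ℝ} (hσ₀ : 1 / 2 ≤ σ₀) (hσ₀1 : σ₀ < 1)
    (hQ : QuasiRiemannHypothesis σ₀) (hδ : 0 < δ) (hδ4 : δ ≤ 1 / 4)
    (hσ1 : σ₀ + 4 * δ ≤ σ) (hσ2 : σ ≤ 3 / 2) (hu : 8 ≤ |u|) :
    Real.log |u| / 2 - 4 - 4 * B₂ * (A₃ / δ ^ 2 * Real.log |u|) ^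
        (Real.log (6 - 2 * σ₀ - 8 * δ) / Real.log (6 - 2 * σ₀ - 4 * δ)) ≤
      (logDeriv riemannXi (((σ : ℝ) : ℂ) + ((-u : ℝ) : ℂ) * I)).re := by
  set s : ℂ := ((σ : ℝ) : ℂ) + ((-u : ℝ) : ℂ) * I with hsdef
  have hsre : s.re = σ := by simp [hsdef]
  have hsim : s.im = -u := by simp [hsdef]
  have hs0 : s ≠ 0 := fun h => by
    have := congrArg Complex.im h; rw [hsim] at this; simp at this; rw [this, abs_zero] at hu; linarith
  have hs1 : s ≠ 1 := fun h => by
    have := congrArg Complex.im h; rw [hsim] at this; simp at this; rw [this, abs_zero] at hu; linarith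
  have hsre0 : 0 < s.re := by rw [hsre]; linarith
  have hζ : riemannZeta s ≠ 0 :=
    InvZetaQuasiRH.riemannZeta_ne_zero_of_quasiRH hQ (by rw [hsre]; linarith)
  have hdec := PsiOneExplicit.logDeriv_riemannZeta_eq_logDeriv_riemannXi (s := s)
    (by rw [hsre]; linarith) hs0 hs1 hζ
  have hξeq : logDeriv riemannXi s =
      deriv riemannZeta s / riemannZeta s + 1 / s + 1 / (s - 1) + logDeriv Gammaℝ s := by
    rw [hdec]; ring
  -- (1) Re(1/s) ≥ 0
  have h1 : 0 ≤ (1 / s).re := by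
    rw [one_div, Complex.inv_re]; exact div_nonneg hsre0.le (Complex.normSq_nonneg _)
  -- (2) Re(1/(s-1)) ≥ -1
  have h2 : -1 ≤ (1 / (s - 1)).re := by
    have hn : ‖1 / (s - 1)‖ ≤ 1 := by
      rw [norm_div, norm_one, div_le_one (norm_pos_iff.2 (sub_ne_zero.2 hs1))]
      have := Complex.abs_im_le_norm (s - 1)
      simp only [sub_im, one_im, sub_zero, hsim, abs_neg] at this
      linarith
    have := Complex.abs_re_le_norm (1 / (s - 1))
    have := neg_abs_le ((1 / (s - 1)).re)
    linarith
  -- (3) Re Γℝ'/Γℝ(s) ≥ (1/2) log|u| − 3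
  have h3 : Real.log |u| / 2 - 3 ≤ (logDeriv Gammaℝ s).re := by
    have := re_logDeriv_Gammaℝ_ge hsre0 (by rw [hsim, abs_neg]; exact hu)
    rw [hsim, abs_neg] at this
    exact this
  -- (4) Re ζ'/ζ(s) ≥ −4 B₂ (A log|u|)^{a₁}
  have hC1 := norm_logDeriv_zeta_le_rpow hQ hσ₀ hσ₀1 hδ hδ4 (t := -u) (by rw [abs_neg]; linarith)
    hσ1 (by linarith)
  rw [abs_neg] at hC1
  rw [← hsdef] at hC1
  have h4 := Complex.abs_re_le_norm (deriv riemannZeta s / riemannZeta s)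
  have h4' := neg_abs_le ((deriv riemannZeta s / riemannZeta s).re)
  have hRe : (logDeriv riemannXi s).re = (deriv riemannZeta s / riemannZeta s).re + (1 / s).re +
      (1 / (s - 1)).re + (logDeriv Gammaℝ s).re := by
    rw [hξeq]; simp only [Complex.add_re]
  rw [hRe]
  linarith [h1, h2, h3, h4, h4', hC1]

/-- **C2 `SymbolDecayOnLines` (RH-FREE implication).** If `ξ ≠ 0` on `Re s > σ₀` (`1/2 ≤ σ₀ < 1`), then for
`θ > 10`, `0 < δ ≤ 1/16` there is `C` with `‖Θ_θ(u+iy)‖ ≤ C · |u|^{−θ/2}` on every line `σ₀ − 1/2 + 4δ ≤ y ≤ 1`, `|u| ≥ 8`. -/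
theorem norm_thetaSym_le_of_zeroFree {θ σ₀ δ : ℝ} (hθ : 10 < θ) (hσ₀ : 1 / 2 ≤ σ₀) (hσ₀1 : σ₀ < 1)
    (hZ : ∀ s : ℂ, σ₀ < s.re → riemannXi s ≠ 0) (hδ : 0 < δ) (hδ16 : δ ≤ 1 / 16) :
    ∃ C : ℝ, ∀ y : ℝ, σ₀ - 1 / 2 + 4 * δ ≤ y → y ≤ 1 → ∀ u : ℝ, 8 ≤ |u| →
      ‖Summit.RiemannHypothesis.RiemannHypothesis.Cruxes.KernelSupport.Birth.thetaSym θ ((u : ℂ) + (y : ℂ) * I)‖ ≤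
        C * |u| ^ (-(θ / 2)) := by
  have hQ : QuasiRiemannHypothesis σ₀ := quasiRH_of_xi_zeroFree (by linarith) hZ
  have hθ0 : 0 < θ := by linarith
  have hδ4 : δ ≤ 1 / 4 := by linarith
  have hδ2 : δ ≤ 1 / 2 := by linarith
  -- constants
  set a₁ : ℝ := Real.log (6 - 2 * σ₀ - 8 * δ) / Real.log (6 - 2 * σ₀ - 4 * δ) with ha₁def
  have ha₁0 : 0 ≤ a₁ := div_nonneg (Real.log_nonneg (by linarith)) (Real.log_nonneg (by linarith))
  have ha₁1 : a₁ < 1 := by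
    rw [ha₁def, div_lt_one (Real.log_pos (by linarith))]
    exact Real.log_lt_log (by linarith) (by linarith)
  set A : ℝ := A₃ / δ ^ 2 with hAdef
  have h40 := forty_le_A₃_div hδ hδ2
  have hA₃pos : 0 < A₃ := by
    have h1 : A₃ = A₃ / δ * δ := by field_simp
    rw [h1]; exact mul_pos (by linarith) hδ
  have hApos : 0 < A := by rw [hAdef]; exact div_pos hA₃pos (pow_pos hδ 2)
  have hA1 : 1 ≤ A := by
    rw [hAdef, le_div_iff₀ (pow_pos hδ 2)]
    have h1 : A₃ = A₃ / δ * δ := by field_simp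
    rw [h1]; nlinarith
  have hB₂ := one_le_B₂
  set ε : ℝ := 1 / (16 * B₂ * A) with hεdef
  have hε : 0 < ε := by rw [hεdef]; positivity
  set K : ℝ := 8 * θ + 8 * θ * B₂ * ε ^ (-(a₁ / (1 - a₁))) with hKdef
  refine ⟨Real.exp K, fun y hy1 hy2 u hu => ?_⟩
  have hu0 : 0 < |u| := by linarith
  set σ : ℝ := 1 / 2 + y with hσdef
  have hσ1 : σ₀ + 4 * δ ≤ σ := by rw [hσdef]; linarith
  have hσ2 : σ ≤ 3 / 2 := by rw [hσdef]; linarith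
  rw [Summit.RiemannHypothesis.RiemannHypothesis.Cruxes.KernelSupport.Birth.norm_thetaSym_line,
    Real.rpow_def_of_pos hu0, ← Real.exp_add, Real.exp_le_exp]
  rw [show ((1 / 2 + y : ℝ) : ℂ) = ((σ : ℝ) : ℂ) by rw [hσdef]]
  have hmain := re_logDeriv_xi_ge (u := u) hσ₀ hσ₀1 hQ hδ hδ4 hσ1 hσ2 hu
  rw [← ha₁def, ← hAdef] at hmain
  -- the sub-logarithmic term: (A log|u|)^{a₁} ≤ ε (A log|u|) + ε^{-(a₁/(1-a₁))}
  have hlog8 : 1 ≤ Real.log |u| := by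
    rw [← Real.log_exp 1]
    refine Real.log_le_log (Real.exp_pos 1) ?_
    have := Real.exp_one_lt_d9; linarith
  have hMge : 1 ≤ A * Real.log |u| := by nlinarith
  have h5 : (A * Real.log |u|) ^ a₁ ≤ ε * (A * Real.log |u|) + ε ^ (-(a₁ / (1 - a₁))) :=
    rpow_le_eps_mul_add hMge ha₁0 ha₁1 hε
  have hεA : 8 * θ * B₂ * (ε * (A * Real.log |u|)) = θ / 2 * Real.log |u| := by
    rw [hεdef]; field_simp; norm_num
  have hθB : 0 ≤ 8 * θ * B₂ := by positivity
  have h6 := mul_le_mul_of_nonneg_left h5 hθB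
  rw [mul_add, hεA] at h6
  -- assemble
  have h7 : -2 * θ * (logDeriv riemannXi (((σ : ℝ) : ℂ) + ((-u : ℝ) : ℂ) * I)).re ≤
      -2 * θ * (Real.log |u| / 2 - 4 - 4 * B₂ * (A * Real.log |u|) ^ a₁) :=
    mul_le_mul_of_nonpos_left hmain (by linarith)
  have h8 : -2 * θ * (Real.log |u| / 2 - 4 - 4 * B₂ * (A * Real.log |u|) ^ a₁) =
      -(θ * Real.log |u|) + 8 * θ + 8 * θ * B₂ * (A * Real.log |u|) ^ a₁ := by ring
  rw [h8] at h7
  rw [hKdef]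
  linarith [h7, h6]

end Summit.RiemannHypothesis.RiemannHypothesis.Theorems.SuzukiWeightedDoorLogDeriv

end
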